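import Literature.NumberTheory.Automorphic.UnitaryGroupAbsorbedFamilyOfLocalAllClasses
import Literature.NumberTheory.Automorphic.UnitaryGroupOrbitalMeasureFamilyOfLocalCongr
import Literature.NumberTheory.Automorphic.UnitaryGroupPatchedFamiliesTransport
import Literature.NumberTheory.Rogawski1990.AdelicStableConjugacy
import HarnessLib

/-!
# The ABSORBED adelic orbital family of the anisotropic `U(H)` at the DITE-PATCHED local data — regular classes: the canonical members; non-regular classes:
# the members of the singular package — with STABLE-CLASS weights (Rogawski (1990), §14.5 pp. 237–239, §4.3 (4.3.1)–(4.3.2), §5.4 (5.4.1), Prop. 10.1.2;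
# Kottwitz (1988), Thm. 1)

Topic `NumberTheory/Automorphic`; namespace `Literature.NumberTheory.Automorphic.UnitaryGroup`; ONE THEOREM (no definition, no instance, no named fact, no `sorry`).
Cell `pub/hodgecm-mathlib`, ENGINE T1 line `F0_T1InnerFormTraceIdentity` (crux item stmt-HodgeConjecture-24833), row **(F-1) «SET ∕ (A-s) ANCHOR FOLD»** (O7 OWNER
WORDS #31∕#35, F0P3a-plan RULING #115 (F1′)): the ED 1.24 anchor's `μA` in ONE call.  INPUT = exactly what MAIN's `anchorWitness_exists_of_packageAnd` holds: the
REGULAR canonical families `mG`, `mGi` with their regular-class pins (canonicity (xi‴) `hcan`, admissibility (ix′) `hadmR`∕`hadmA`, Weil form and coherence (W′)(C′)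
`hW`∕`hC`, normalisation (xiv) `hnormR`), the SINGULAR members `mGs`, `mGis` of ★ `Rogawski1990.SingularEllipticTransfer[Canonical]` with its clauses (ADM) `hadmS`∕
`hadmAS`, (NORM) `hnormS`, (K7-s) `hK7S` VERBATIM, and ANY patched pair `(mGp, mGip)` agreeing with `(mG, mGi)` AT the regular classes and with `(mGs, mGis)` OFF them
(MAIN: `w.mGp v c := if IsRegularElt (out c).val then w.mG v c else w.mGs v c`).  OUTPUT = ★ (A-s) `exists_absorbedFamily_ofLocal_stableCovolWeight`'s conclusion
at `(mGp, mGip)` — `μA` admissible at every class, `Φ_{μA}(·, F)` finitely supported, the weight-free O-expansion of `θ_{G′}`, `α > 0` on the stable classes with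
`μA c = α(𝒪_st c) • ofLocal mGp mGip c` for ALL `c` — plus its two readings `= α • ofLocal mG mGi c` at the regular `c` (MAIN's `hβ`, pin (viii⁵) VERBATIM) and
`= α • ofLocal mGs mGis c` at the non-regular `c` (MAIN's `hβs`; pins (viii⁵-s)(viii⁵-c)) by ★ `AdelicOrbitalMeasureFamily.ofLocal_congr`.
PROOF = assembly: the regular-class pins move to `(mGp, mGip)` by ★ `UnitaryGroupPatchedFamiliesTransport` §1 (`if_pos`); the all-classes riders `hadm`∕`hadmA′`∕`hnorm`
of ★ (A-s) are the regular pins at regular `c` (★ `isAdmissibleOn_at_toLocal_toAdelic`, ★ `isAdmissibleOn_at_archPart_toAdelic`) and (ADM)(NORM) at non-regular `c`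
(the class of `(γ_c)_v` corresponds to `(γ_c)_v`: ★ `corresponds_self_iff` ∘ ★ `isStablyConj_of_isConj`; it is non-regular: ★ `not_isRegularElt_toLocal_toAdelic`);
`hstab_s` is (K7-s) moved from `ofLocal mGs mGis` to `ofLocal mGp mGip` by ★ `ofLocal_congr` at the non-regular classes.
HC_CM is proved only modulo the printed citations (7 + `SingularEllipticTransfer[Canonical]`) until rung 0 closes; (K7-s) stays a clause of that printed fact.

References: J. D. Rogawski, *Automorphic Representations of Unitary Groups in Three Variables* (1990), §4.3 pp. 43–44, §5.4 (5.4.1) p. 72, Prop. 10.1.2 p. 146,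
§14.5 pp. 237–239 [Rogawski1990]; R. E. Kottwitz, *Tamagawa numbers*, Ann. of Math. 127 (1988), Thm. 1 [Kottwitz1988]; A. Deitmar, S. Echterhoff, *Principles of
Harmonic Analysis* (2014), Thm. 1.5.3 [DeitmarEchterhoff2014].
-/

set_option autoImplicit false

noncomputable section

open _root_.MeasureTheory _root_.MeasureTheory.Measure Set NumberField IsDedekindDomain
open _root_.Topology
open Literature.MeasureTheory.Group Literature.NumberTheory.Rogawski1990
open scoped ENNReal NNReal Matrix

namespace Literature.NumberTheory.Automorphic

namespace UnitaryGroup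

open CompactlySupported
open Literature.AlgebraicGeometry.ShimuraVarieties (hermForm)

variable (L : Type) [Field L] [NumberField L] [IsCMField L] (N : ℕ) (H : Matrix (Fin N) (Fin N) L)
  [∀ g : (cmDatum L N H).Adelic, MeasurableSpace ((cmDatum L N H).Adelic ⧸ Subgroup.centralizer ({g} : Set (cmDatum L N H).Adelic))]
  [∀ g : (cmDatum L N H).Adelic, BorelSpace ((cmDatum L N H).Adelic ⧸ Subgroup.centralizer ({g} : Set (cmDatum L N H).Adelic))]
  [∀ a : (arch (↥(maximalRealSubfield L)) L (IsCMField.complexConj L) N H), MeasurableSpace ((arch (↥(maximalRealSubfield L)) L (IsCMField.complexConj L) N H) ⧸ Subgroup.centralizer ({a} : Set (arch (↥(maximalRealSubfield L)) L (IsCMField.complexConj L) N H)))]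
  [∀ a : (arch (↥(maximalRealSubfield L)) L (IsCMField.complexConj L) N H), BorelSpace ((arch (↥(maximalRealSubfield L)) L (IsCMField.complexConj L) N H) ⧸ Subgroup.centralizer ({a} : Set (arch (↥(maximalRealSubfield L)) L (IsCMField.complexConj L) N H)))]
  [∀ (v : HeightOneSpectrum (𝓞 ↥(maximalRealSubfield L))) (x : (cmDatum L N H).Local v),
    MeasurableSpace ((cmDatum L N H).Local v ⧸ Subgroup.centralizer ({x} : Set ((cmDatum L N H).Local v)))]
  [∀ (v : HeightOneSpectrum (𝓞 ↥(maximalRealSubfield L))) (x : (cmDatum L N H).Local v),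
    BorelSpace ((cmDatum L N H).Local v ⧸ Subgroup.centralizer ({x} : Set ((cmDatum L N H).Local v)))]
  [∀ v, MeasurableSpace ((cmDatum L N H).Local v)] [∀ v, BorelSpace ((cmDatum L N H).Local v)]
  [MeasurableSpace (cmDatum L N H).Adelic] [BorelSpace (cmDatum L N H).Adelic]
  [MeasurableSpace (arch (↥(maximalRealSubfield L)) L (IsCMField.complexConj L) N H)] [BorelSpace (arch (↥(maximalRealSubfield L)) L (IsCMField.complexConj L) N H)]
  [∀ γ : (cmDatum L N H).Adelic, MeasurableSpace (↥(Subgroup.centralizer ({γ} : Set (cmDatum L N H).Adelic)) ⧸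
    ((cmDatum L N H).quotientSubgroup ⊓ Subgroup.centralizer ({γ} : Set (cmDatum L N H).Adelic)).subgroupOf
      (Subgroup.centralizer ({γ} : Set (cmDatum L N H).Adelic)))]
  [∀ γ : (cmDatum L N H).Adelic, BorelSpace (↥(Subgroup.centralizer ({γ} : Set (cmDatum L N H).Adelic)) ⧸
    ((cmDatum L N H).quotientSubgroup ⊓ Subgroup.centralizer ({γ} : Set (cmDatum L N H).Adelic)).subgroupOf
      (Subgroup.centralizer ({γ} : Set (cmDatum L N H).Adelic)))]
  [hCcl : ∀ γ : (cmDatum L N H).Adelic, IsClosed ((Subgroup.centralizer ({γ} : Set (cmDatum L N H).Adelic) :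
    Subgroup (cmDatum L N H).Adelic) : Set (cmDatum L N H).Adelic)]
  [∀ γ : (cmDatum L N H).Adelic, (count : Measure ↥(((cmDatum L N H).quotientSubgroup ⊓
    Subgroup.centralizer ({γ} : Set (cmDatum L N H).Adelic)).subgroupOf
      (Subgroup.centralizer ({γ} : Set (cmDatum L N H).Adelic)))).IsHaarMeasure]

/-- **(F-1) THE ABSORBED FAMILY AT THE PATCHED LOCAL DATA, STABLE-CLASS WEIGHTS, WITH ITS REGULAR AND SINGULAR READINGS.**  See the module docstring: inputs =
MAIN's regular canonical families + their regular-class pins, the singular members of ★ `SingularEllipticTransfer[Canonical]` with (ADM)(NORM)(K7-s) verbatim,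
and any patched pair agreeing with the former at the regular classes and with the latter off them; output = ★ (A-s) at the patched pair + the two readings
(MAIN's `hβ` at the regular classes, `hβs` at the non-regular ones).  The honest label is unchanged: (K7-s) is a clause of the printed singular package.
[cite: Rogawski1990, §14.5 pp. 237–239; §4.3 (4.3.1)–(4.3.2) pp. 43–44; §5.4 (5.4.1) p. 72; Prop. 10.1.2 p. 146] [cite: Kottwitz1988, Thm. 1]
[cite: DeitmarEchterhoff2014, Thm. 1.5.3] -/
theorem exists_absorbedFamily_ofLocal_patched
    (hanis : ∀ x : Fin N → L, hermForm (cmConjRingHom L) H x x = 0 → x = 0)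
    (hH : (H.map (cmConjRingHom L))ᵀ = H) (hHd : H.det ≠ 0)
    (ν : ∀ v, Measure ((cmDatum L N H).Local v)) [∀ v, IsHaarMeasure (ν v)] [∀ v, (ν v).IsMulRightInvariant]
    (hK : ∀ v, ν v (cmLocalIntegralLevel L N H v : Set ((cmDatum L N H).Local v)) = 1)
    -- the REGULAR canonical families and their regular-class pins (MAIN: (xi‴) `hcan`, (ix′) `hadmR`∕`hadmA`, (xiv) `hnormR`, (W′) `hW`, (C′) `hC`)
    (mG : ∀ v : HeightOneSpectrum (𝓞 ↥(maximalRealSubfield L)), OrbitalMeasureFamily ((cmDatum L N H).Local v))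
    (hcan : ∀ v, (mG v).IsCanonical (fun x => IsRegularElt (x.val : GL (Fin N) (LocalRing L v))) (ν v))
    (hadmR : ∀ v, (mG v).IsAdmissibleOn (fun x => IsRegularElt (x.val : GL (Fin N) (LocalRing L v))))
    (hnormR : ∀ c : ConjClasses (cmDatum L N H).Rational, IsRegularElt ((Quotient.out c).val : GL (Fin N) L) →
      ∃ S₀ : Finset (HeightOneSpectrum (𝓞 ↥(maximalRealSubfield L))), IsNormalisedOff L N H mG ((cmDatum L N H).toAdelic (Quotient.out c)) S₀)
    (mGi : OrbitalMeasureFamily (arch (↥(maximalRealSubfield L)) L (IsCMField.complexConj L) N H))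
    (νGi : Measure (arch (↥(maximalRealSubfield L)) L (IsCMField.complexConj L) N H)) [IsFiniteMeasureOnCompacts νGi] [νGi.IsMulRightInvariant]
    (t' : ∀ γ' : arch (↥(maximalRealSubfield L)) L (IsCMField.complexConj L) N H, Measure (Subgroup.centralizer ({γ'} : Set _)))
    (hW : mGi.IsQuotientOf (fun γ => IsRegularElt (γ.val : GL (Fin N) (mixedEmbedding.mixedSpace L))) νGi t')
    (hC : ∀ (γ₁ γ₂ : arch (↥(maximalRealSubfield L)) L (IsCMField.complexConj L) N H)
        (h₁ : IsRegularElt (γ₁.val : GL (Fin N) (mixedEmbedding.mixedSpace L)))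
        (hc : Corresponds (conjMixed (↥(maximalRealSubfield L)) L (IsCMField.complexConj L)) (archFormOf L N H) (archFormOf L N H) γ₁ γ₂),
        Measure.map (archStableCentralizerEquiv L hHd hHd hc h₁) (t' γ₁) = t' γ₂)
    (hadmA : mGi.IsAdmissibleOn (fun γ => IsRegularElt (γ.val : GL (Fin N) (mixedEmbedding.mixedSpace L))))
    -- the SINGULAR members and the clauses (ADM)(NORM)(K7-s) of the singular package, VERBATIM
    (mGs : ∀ v : HeightOneSpectrum (𝓞 ↥(maximalRealSubfield L)), OrbitalMeasureFamily ((cmDatum L N H).Local v))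
    (mGis : OrbitalMeasureFamily (arch (↥(maximalRealSubfield L)) L (IsCMField.complexConj L) N H))
    (hadmS : ∀ γ₀ : (cmDatum L N H).Rational, ¬ IsRegularElt (γ₀.val : GL (Fin N) L) →
      ∀ v, (mGs v).IsAdmissibleOn fun x : (cmDatum L N H).Local v =>
        Corresponds (conjLocal L (IsCMField.complexConj L) v) ((adelicForm L N H).map (adeleToLocal L v)) ((adelicForm L N H).map (adeleToLocal L v))
          ((cmDatum L N H).toLocal v ((cmDatum L N H).toAdelic γ₀)) x)
    (hadmAS : ∀ γ₀ : (cmDatum L N H).Rational, ¬ IsRegularElt (γ₀.val : GL (Fin N) L) →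
      mGis.IsAdmissibleOn fun x : arch (↥(maximalRealSubfield L)) L (IsCMField.complexConj L) N H =>
        Corresponds (conjMixed (↥(maximalRealSubfield L)) L (IsCMField.complexConj L)) (archFormOf L N H) (archFormOf L N H) (cmRationalToArch L N H γ₀) x)
    (hnormS : ∀ γ₀ : (cmDatum L N H).Rational, ¬ IsRegularElt (γ₀.val : GL (Fin N) L) →
      ∃ S₀ : Finset (HeightOneSpectrum (𝓞 ↥(maximalRealSubfield L))), IsNormalisedOff L N H mGs ((cmDatum L N H).toAdelic γ₀) S₀)
    (νA : Measure (cmDatum L N H).Adelic) [νA.IsHaarMeasure] [νA.IsMulRightInvariant]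
    (μ : Measure (cmDatum L N H).automorphicQuotient) [(cmDatum L N H).IsAutomorphicMeasure μ]
    (hK7S : ∀ (νZ : ∀ c : ConjClasses (cmDatum L N H).Rational,
        Measure ↥(Subgroup.centralizer ({(cmDatum L N H).toAdelic (Quotient.out c)} : Set (cmDatum L N H).Adelic)))
      (_ : ∀ c, IsHaarMeasure (νZ c)) (_ : ∀ c, (νZ c).IsMulRightInvariant) (_ : ∀ c, (νZ c).IsInvInvariant),
      (∀ c, ¬ IsRegularElt ((Quotient.out c).val : GL (Fin N) L) →
        AdelicOrbitalMeasureFamily.ofLocal L N H mGs mGis c =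
          quotientMeasure (Subgroup.centralizer ({(cmDatum L N H).toAdelic (Quotient.out c)} : Set (cmDatum L N H).Adelic)) (νZ c) (hCcl _) νA) →
      ∀ c c' : ConjClasses (cmDatum L N H).Rational, ¬ IsRegularElt ((Quotient.out c).val : GL (Fin N) L) →
        StableClass.ofConjClass c = StableClass.ofConjClass c' →
        quotientMeasure (((cmDatum L N H).quotientSubgroup ⊓
            Subgroup.centralizer ({(cmDatum L N H).toAdelic (Quotient.out c)} : Set (cmDatum L N H).Adelic)).subgroupOf
            (Subgroup.centralizer ({(cmDatum L N H).toAdelic (Quotient.out c)} : Set (cmDatum L N H).Adelic))) count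
            (isClosed_subgroupOf _ _ ((isClosed_cmDatum_quotientSubgroup L N H).inter (hCcl _))) (νZ c) Set.univ =
          quotientMeasure (((cmDatum L N H).quotientSubgroup ⊓
            Subgroup.centralizer ({(cmDatum L N H).toAdelic (Quotient.out c')} : Set (cmDatum L N H).Adelic)).subgroupOf
            (Subgroup.centralizer ({(cmDatum L N H).toAdelic (Quotient.out c')} : Set (cmDatum L N H).Adelic))) count
            (isClosed_subgroupOf _ _ ((isClosed_cmDatum_quotientSubgroup L N H).inter (hCcl _))) (νZ c') Set.univ)
    -- the PATCHED pair: regular members from `(mG, mGi)`, the others from `(mGs, mGis)`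
    (mGp : ∀ v : HeightOneSpectrum (𝓞 ↥(maximalRealSubfield L)), OrbitalMeasureFamily ((cmDatum L N H).Local v))
    (mGip : OrbitalMeasureFamily (arch (↥(maximalRealSubfield L)) L (IsCMField.complexConj L) N H))
    (hPr : ∀ v (c : ConjClasses ((cmDatum L N H).Local v)), IsRegularElt ((Quotient.out c).val : GL (Fin N) (LocalRing L v)) → mGp v c = mG v c)
    (hPs : ∀ v (c : ConjClasses ((cmDatum L N H).Local v)), ¬ IsRegularElt ((Quotient.out c).val : GL (Fin N) (LocalRing L v)) → mGp v c = mGs v c)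
    (hPir : ∀ c : ConjClasses (arch (↥(maximalRealSubfield L)) L (IsCMField.complexConj L) N H),
      IsRegularElt ((Quotient.out c).val : GL (Fin N) (mixedEmbedding.mixedSpace L)) → mGip c = mGi c)
    (hPis : ∀ c : ConjClasses (arch (↥(maximalRealSubfield L)) L (IsCMField.complexConj L) N H),
      ¬ IsRegularElt ((Quotient.out c).val : GL (Fin N) (mixedEmbedding.mixedSpace L)) → mGip c = mGis c) :
    ∃ μA : AdelicOrbitalMeasureFamily L N H,
      (∀ c : ConjClasses (cmDatum L N H).Rational,
          SMulInvariantMeasure (cmDatum L N H).Adelic _ (μA c) ∧ IsFiniteMeasureOnCompacts (μA c) ∧ μA c ≠ 0) ∧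
      (∀ F : C_c((cmDatum L N H).Adelic, ℂ), (Function.support (adelicClassOrbitalIntegral L N H μA F)).Finite) ∧
      (∀ F : C_c((cmDatum L N H).Adelic, ℂ), diagTrace L N H μ νA hanis F =
        ∑ᶠ st : StableClass (cmConjRingHom L) H, st.orbitalSum (adelicClassOrbitalIntegral L N H μA F)) ∧
      ∃ α : StableClass (cmConjRingHom L) H → ℝ, (∀ 𝒪, 0 < α 𝒪) ∧
        (∀ c : ConjClasses (cmDatum L N H).Rational,
          μA c = ENNReal.ofReal (α (StableClass.ofConjClass c)) • AdelicOrbitalMeasureFamily.ofLocal L N H mGp mGip c) ∧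
        (∀ c : ConjClasses (cmDatum L N H).Rational, IsRegularElt ((Quotient.out c).val : GL (Fin N) L) →
          μA c = ENNReal.ofReal (α (StableClass.ofConjClass c)) • AdelicOrbitalMeasureFamily.ofLocal L N H mG mGi c) ∧
        (∀ c : ConjClasses (cmDatum L N H).Rational, ¬ IsRegularElt ((Quotient.out c).val : GL (Fin N) L) →
          μA c = ENNReal.ofReal (α (StableClass.ofConjClass c)) • AdelicOrbitalMeasureFamily.ofLocal L N H mGs mGis c) := by
  -- regularity of the classes `⟦(γ)_v⟧`, `⟦γ_∞⟧` of a rational `γ` is regularity of `γ`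
  have hnregv : ∀ (γ : (cmDatum L N H).Rational) (v : HeightOneSpectrum (𝓞 ↥(maximalRealSubfield L))), ¬ IsRegularElt (γ.val : GL (Fin N) L) →
      ¬ IsRegularElt ((Quotient.out (ConjClasses.mk ((cmDatum L N H).toLocal v ((cmDatum L N H).toAdelic γ)))).val : GL (Fin N) (LocalRing L v)) :=
    fun γ v h hreg => not_isRegularElt_toLocal_toAdelic L γ h v ((isRegularElt_iff_of_isConj_local L H v (isConj_out_conjClasses_mk _)).2 hreg)
  have hnregi : ∀ γ : (cmDatum L N H).Rational, ¬ IsRegularElt (γ.val : GL (Fin N) L) →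
      ¬ IsRegularElt ((Quotient.out (ConjClasses.mk (archPart (↥(maximalRealSubfield L)) L (IsCMField.complexConj L) N H ((cmDatum L N H).toAdelic γ)))).val :
        GL (Fin N) (mixedEmbedding.mixedSpace L)) := by
    intro γ h hreg
    refine not_isRegularElt_cmRationalToArch L γ h ?_
    rw [← archPart_cmDatum_toAdelic]
    exact (isRegularElt_iff_of_isConj_arch (isConj_out_conjClasses_mk _)).2 hreg
  -- the members at `⟦(γ_c)_v⟧`, `⟦(γ_c)_∞⟧`: patched = regular at regular `c`, patched = singular at non-regular `c`
  have hGr : ∀ c : ConjClasses (cmDatum L N H).Rational, IsRegularElt ((Quotient.out c).val : GL (Fin N) L) → ∀ v,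
      mG v (ConjClasses.mk ((cmDatum L N H).toLocal v ((cmDatum L N H).toAdelic (Quotient.out c)))) =
        mGp v (ConjClasses.mk ((cmDatum L N H).toLocal v ((cmDatum L N H).toAdelic (Quotient.out c)))) :=
    fun c hc v => (hPr v _ (isRegularElt_out_mk_toLocal_toAdelic L H (Quotient.out c) hc v)).symm
  have hGs : ∀ c : ConjClasses (cmDatum L N H).Rational, ¬ IsRegularElt ((Quotient.out c).val : GL (Fin N) L) → ∀ v,
      mGs v (ConjClasses.mk ((cmDatum L N H).toLocal v ((cmDatum L N H).toAdelic (Quotient.out c)))) =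
        mGp v (ConjClasses.mk ((cmDatum L N H).toLocal v ((cmDatum L N H).toAdelic (Quotient.out c)))) :=
    fun c hc v => (hPs v _ (hnregv (Quotient.out c) v hc)).symm
  have hGir : ∀ c : ConjClasses (cmDatum L N H).Rational, IsRegularElt ((Quotient.out c).val : GL (Fin N) L) →
      mGi (ConjClasses.mk (archPart (↥(maximalRealSubfield L)) L (IsCMField.complexConj L) N H ((cmDatum L N H).toAdelic (Quotient.out c)))) =
        mGip (ConjClasses.mk (archPart (↥(maximalRealSubfield L)) L (IsCMField.complexConj L) N H ((cmDatum L N H).toAdelic (Quotient.out c)))) :=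
    fun c hc => (hPir _ (isRegularElt_out_mk_archPart_toAdelic L H (Quotient.out c) hc)).symm
  have hGis : ∀ c : ConjClasses (cmDatum L N H).Rational, ¬ IsRegularElt ((Quotient.out c).val : GL (Fin N) L) →
      mGis (ConjClasses.mk (archPart (↥(maximalRealSubfield L)) L (IsCMField.complexConj L) N H ((cmDatum L N H).toAdelic (Quotient.out c)))) =
        mGip (ConjClasses.mk (archPart (↥(maximalRealSubfield L)) L (IsCMField.complexConj L) N H ((cmDatum L N H).toAdelic (Quotient.out c)))) :=
    fun c hc => (hPis _ (hnregi (Quotient.out c) hc)).symm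
  -- admissible triples at `⟦(γ_c)_v⟧`, `⟦(γ_c)_∞⟧`: regular pins at regular `c`, (ADM) at non-regular `c`
  have hadmRat : ∀ (c : ConjClasses (cmDatum L N H).Rational) v, IsRegularElt ((Quotient.out c).val : GL (Fin N) L) →
      mG v (ConjClasses.mk ((cmDatum L N H).toLocal v ((cmDatum L N H).toAdelic (Quotient.out c)))) ≠ 0 ∧
      SMulInvariantMeasure ((cmDatum L N H).Local v) _ (mG v (ConjClasses.mk ((cmDatum L N H).toLocal v ((cmDatum L N H).toAdelic (Quotient.out c))))) ∧
      IsFiniteMeasureOnCompacts (mG v (ConjClasses.mk ((cmDatum L N H).toLocal v ((cmDatum L N H).toAdelic (Quotient.out c))))) :=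
    fun c v hc => isAdmissibleOn_at_toLocal_toAdelic L H v (hadmR v) (Quotient.out c) hc
  have hadmSat : ∀ (c : ConjClasses (cmDatum L N H).Rational) v, ¬ IsRegularElt ((Quotient.out c).val : GL (Fin N) L) →
      mGs v (ConjClasses.mk ((cmDatum L N H).toLocal v ((cmDatum L N H).toAdelic (Quotient.out c)))) ≠ 0 ∧
      SMulInvariantMeasure ((cmDatum L N H).Local v) _ (mGs v (ConjClasses.mk ((cmDatum L N H).toLocal v ((cmDatum L N H).toAdelic (Quotient.out c))))) ∧
      IsFiniteMeasureOnCompacts (mGs v (ConjClasses.mk ((cmDatum L N H).toLocal v ((cmDatum L N H).toAdelic (Quotient.out c))))) :=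
    fun c v hc => (hadmS (Quotient.out c) hc v).at_mk _ (corresponds_self_iff.2 (isStablyConj_of_isConj (isConj_out_conjClasses_mk _)))
  have hadmARat : ∀ c : ConjClasses (cmDatum L N H).Rational, IsRegularElt ((Quotient.out c).val : GL (Fin N) L) →
      mGi (ConjClasses.mk (archPart (↥(maximalRealSubfield L)) L (IsCMField.complexConj L) N H ((cmDatum L N H).toAdelic (Quotient.out c)))) ≠ 0 ∧
      SMulInvariantMeasure (arch (↥(maximalRealSubfield L)) L (IsCMField.complexConj L) N H) _
        (mGi (ConjClasses.mk (archPart (↥(maximalRealSubfield L)) L (IsCMField.complexConj L) N H ((cmDatum L N H).toAdelic (Quotient.out c))))) ∧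
      IsFiniteMeasureOnCompacts (mGi (ConjClasses.mk (archPart (↥(maximalRealSubfield L)) L (IsCMField.complexConj L) N H ((cmDatum L N H).toAdelic (Quotient.out c))))) :=
    fun c hc => isAdmissibleOn_at_archPart_toAdelic L H hadmA (Quotient.out c) hc
  have hadmASat : ∀ c : ConjClasses (cmDatum L N H).Rational, ¬ IsRegularElt ((Quotient.out c).val : GL (Fin N) L) →
      mGis (ConjClasses.mk (archPart (↥(maximalRealSubfield L)) L (IsCMField.complexConj L) N H ((cmDatum L N H).toAdelic (Quotient.out c)))) ≠ 0 ∧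
      SMulInvariantMeasure (arch (↥(maximalRealSubfield L)) L (IsCMField.complexConj L) N H) _
        (mGis (ConjClasses.mk (archPart (↥(maximalRealSubfield L)) L (IsCMField.complexConj L) N H ((cmDatum L N H).toAdelic (Quotient.out c))))) ∧
      IsFiniteMeasureOnCompacts (mGis (ConjClasses.mk (archPart (↥(maximalRealSubfield L)) L (IsCMField.complexConj L) N H ((cmDatum L N H).toAdelic (Quotient.out c))))) := by
    intro c hc
    refine (hadmAS (Quotient.out c) hc).at_mk _ ?_
    rw [← archPart_cmDatum_toAdelic]
    exact corresponds_self_iff.2 (isStablyConj_of_isConj (isConj_out_conjClasses_mk _))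
  -- ★ `ofLocal_congr`: the patched `ofLocal` IS the regular ∕ singular `ofLocal` at the regular ∕ non-regular classes
  have hcongrR : ∀ c : ConjClasses (cmDatum L N H).Rational, IsRegularElt ((Quotient.out c).val : GL (Fin N) L) →
      AdelicOrbitalMeasureFamily.ofLocal L N H mG mGi c = AdelicOrbitalMeasureFamily.ofLocal L N H mGp mGip c := by
    intro c hc
    obtain ⟨S₀, hS₀⟩ := hnormR c hc
    exact AdelicOrbitalMeasureFamily.ofLocal_congr L N H mG mGp mGi mGip c hS₀ (fun v => hadmRat c v hc) (hGr c hc) (hGir c hc)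
  have hcongrS : ∀ c : ConjClasses (cmDatum L N H).Rational, ¬ IsRegularElt ((Quotient.out c).val : GL (Fin N) L) →
      AdelicOrbitalMeasureFamily.ofLocal L N H mGs mGis c = AdelicOrbitalMeasureFamily.ofLocal L N H mGp mGip c := by
    intro c hc
    obtain ⟨S₀, hS₀⟩ := hnormS (Quotient.out c) hc
    exact AdelicOrbitalMeasureFamily.ofLocal_congr L N H mGs mGp mGis mGip c hS₀ (fun v => hadmSat c v hc) (hGs c hc) (hGis c hc)
  -- ★ (A-s) at the patched pair
  obtain ⟨μA, hμA, hsupp, hJ, α, hα, hβ⟩ :=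
    exists_absorbedFamily_ofLocal_stableCovolWeight L N H hanis hH hHd ν hK mGp
      (fun v => OrbitalMeasureFamily.isCanonical_of_eqOn (ν v) (hPr v) (hcan v)) mGip νGi t'
      (OrbitalMeasureFamily.isQuotientOf_of_eqOn νGi t' hPir hW) hC (OrbitalMeasureFamily.isAdmissibleOn_of_eqOn hPir hadmA) νA μ
      (fun c v => by
        by_cases hc : IsRegularElt ((Quotient.out c).val : GL (Fin N) L)
        · rw [← hGr c hc v]; exact hadmRat c v hc
        · rw [← hGs c hc v]; exact hadmSat c v hc)
      (fun c => by
        by_cases hc : IsRegularElt ((Quotient.out c).val : GL (Fin N) L)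
        · rw [← hGir c hc]; exact hadmARat c hc
        · rw [← hGis c hc]; exact hadmASat c hc)
      (fun c => by
        by_cases hc : IsRegularElt ((Quotient.out c).val : GL (Fin N) L)
        · obtain ⟨S₀, hS₀⟩ := hnormR c hc
          exact ⟨S₀, isNormalisedOff_congr_point L mG mGp _ S₀ (fun v => (hGr c hc v).symm) hS₀⟩
        · exact exists_isNormalisedOff_of_eqOn_not_regular L hPs (Quotient.out c) hc (hnormS (Quotient.out c) hc))
      (fun νZ h₁ h₂ h₃ hνZ c c' hc hcc' =>
        hK7S νZ h₁ h₂ h₃ (fun c₀ hc₀ => (hcongrS c₀ hc₀).trans (hνZ c₀)) c c' hc hcc')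
  exact ⟨μA, hμA, hsupp, hJ, α, hα, hβ, fun c hc => (hβ c).trans (by rw [hcongrR c hc]), fun c hc => (hβ c).trans (by rw [hcongrS c hc])⟩

end UnitaryGroup

end Literature.NumberTheory.Automorphic

end
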